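import Summits.CriticalPhenomena.PercolationContinuityZ3.Theorems.PercNearOneGluingNoHeavyLowerTailQuantitativeBHKLevelZeroFloors
import Summits.CriticalPhenomena.PercolationContinuityZ3.Theorems.PercNearOneGluingNoHeavyLowerTailQuantitativeBHKBlocking
import HarnessLib

/-!
# Level-0 CSH margin with the repulsion slack floored by the BLOCKING member

Support file (`--supports stmt-CriticalPhenomena-4575`), prover seat `prim-rate-mine-2` (lane prim-rate, constants-miner (c), BENCH row
M2-R12 with the (blk) member of row M2-R11; `run/shared/lean/prim/prim-rate/prim-rate-mine-2/CANDIDATES.md` §gen-3).  No definitions, no named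
facts, no sorries; standard axioms.  Notation of `QuantBHK.level0Margin_eq_harris_add_repulsion` (`D = {x ↮ v}`, `B = {x↔b}`, `Q = {v↔x}`,
`O_x = {o↔x}`, `O_v = {o↔v}`, `U = O_x ∪ O_v`, `m = μ(B)`) and of `QuantBHK.twoCluster_repulsion_openConn_ge_blocking` (weights supported on `E`,
blocking potential `φ = −P_{C_x}(v↔o)`, level-`r` hull event `H_r`): the exact identity `margin = Harris + R` combined with the layer-cake blocking
floor for `R` gives

  `μ(D∩O_v)(μ(Q∩B) − μ(Q)m) + μ(D)(μ(U∩B) − μ(U)m) + ∫_{(−1,0]} μ(D ∩ {φ > r})·μ(D ∩ H_r) dr ≤ μ(D)(μ(O_x∩B) − μ(O_x)m)`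

(`QuantBHK.level0Margin_ge_harris_add_blocking`) — with `…_add_deletion` (p316673), `…_add_attachment`, `…_add_glauber` (p318759) every member of
the repulsion floor family sits under the level-0 CSH / K6 margin in the kernel.
[cite: VandenbergHaggstromKahn2005, Thm. 1.4 and eq. (2) (pp. 2, 7)] [cite: Harris1960, Lemma 4.1 (p. 16)]
-/

noncomputable section

namespace Summit.CriticalPhenomena.PercolationContinuityZ3.Theorems

open MeasureTheory Set Literature.Probability.LatticeModels Literature.Probability.Percolation
open scoped Classical

namespace QuantBHK

universe v

variable {V : Type v} [Fintype V]

/-- **Level-0 CSH margin, repulsion slack floored by the BLOCKING member (row M2-R12 × M2-R11 (blk)).**  Weights supported on `E`, `x ≠ v`;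
with `D = {x↮v}`, `B = {x↔b}`, `Q = {v↔x}`, `O_x = {o↔x}`, `O_v = {o↔v}`, `U = O_x ∪ O_v`, `m = μ(B)`, `φ(ω) = −P_{C_x(ω)}(v↔o)` and `H_r` the
level-`r` hull event («`φ ≤ r`, `b ∉ C_x`, every extension attached to `C_x` by `E`-pairs avoiding `v` with `φ_U > r` contains `b`»):
`μ(D∩O_v)(μ(Q∩B) − μ(Q)m) + μ(D)(μ(U∩B) − μ(U)m) + ∫_{r∈(−1,0]} μ(D∩{r<φ})·μ(D∩H_r) dr ≤ μ(D)(μ(O_x∩B) − μ(O_x)m)`.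
[cite: VandenbergHaggstromKahn2005, Thm. 1.4 and eq. (2) (pp. 2, 7)] [cite: Harris1960, Lemma 4.1 (p. 16)] -/
theorem level0Margin_ge_harris_add_blocking (w : Sym2 V → unitInterval) (E : Set (Sym2 V))
    (hE : ∀ e, e ∉ E → (w e : ℝ) = 0) (x b o v : V) (hxv : x ≠ v) :
    (prodBernoulli w).real ({ω : BondConfig V | ¬ (openGraph ω).Reachable x v} ∩ openConn o v) *
          ((prodBernoulli w).real (openConn v x ∩ openConn x b) -
            (prodBernoulli w).real (openConn v x) * (prodBernoulli w).real (openConn x b)) +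
        (prodBernoulli w).real {ω : BondConfig V | ¬ (openGraph ω).Reachable x v} *
          ((prodBernoulli w).real ((openConn o x ∪ openConn o v) ∩ openConn x b) -
            (prodBernoulli w).real (openConn o x ∪ openConn o v) * (prodBernoulli w).real (openConn x b)) +
        ∫ r in Set.Ioc (-1 : ℝ) 0,
          (prodBernoulli w).real ({ω : BondConfig V | ¬ (openGraph ω).Reachable x v} ∩
              {ω | r < -(prodBernoulli w).real {η : BondConfig V |
                (openGraph (η \ {e | ∃ z ∈ e, z ∈ openCluster ω x})).Reachable v o}}) *
            (prodBernoulli w).real ({ω : BondConfig V | ¬ (openGraph ω).Reachable x v} ∩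
              {ω | -(prodBernoulli w).real {η : BondConfig V |
                    (openGraph (η \ {e | ∃ z ∈ e, z ∈ openCluster ω x})).Reachable v o} ≤ r ∧
                  b ∉ openCluster ω x ∧
                  ∀ U : Set V, (∀ u ∈ U, (openGraph {e | (e ∈ E ∧ v ∉ e) ∧
                      ∀ z ∈ e, z ∈ openCluster ω x ∨ z ∈ U}).Reachable x u) →
                    r < -(prodBernoulli w).real {η : BondConfig V |
                      (openGraph (η \ {e | ∃ z ∈ e, z ∈ openCluster ω x ∨ z ∈ U})).Reachable v o} →
                    b ∈ openCluster ω x ∨ b ∈ U}) ≤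
      (prodBernoulli w).real {ω : BondConfig V | ¬ (openGraph ω).Reachable x v} *
        ((prodBernoulli w).real (openConn o x ∩ openConn x b) -
          (prodBernoulli w).real (openConn o x) * (prodBernoulli w).real (openConn x b)) := by
  have hid := level0Margin_eq_harris_add_repulsion w x b o v
  have hrep := twoCluster_repulsion_openConn_ge_blocking w E hE x v b o hxv
  have hvo : (openConn v o : Set (BondConfig V)) = openConn o v := KNPreFKG.openConn_symm v o
  have hDBO : {ω : BondConfig V | ¬ (openGraph ω).Reachable x v} ∩ openConn x b ∩ openConn o v =
      {ω : BondConfig V | ¬ (openGraph ω).Reachable x v} ∩ openConn o v ∩ openConn x b := by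
    rw [Set.inter_assoc, Set.inter_comm (openConn x b) (openConn o v), ← Set.inter_assoc]
  rw [hvo, hDBO] at hrep
  linarith [hid, hrep]

end QuantBHK

end Summit.CriticalPhenomena.PercolationContinuityZ3.Theorems
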